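import Mathlib.Analysis.InnerProductSpace.Basic
import Mathlib.Analysis.InnerProductSpace.PiL2
import HarnessLib

/-!
# Gram bound for the coefficient vector of a finite family

Analysis/OperatorTheory file (everything proved, no named facts). Let `E` be a real inner product
space, `a : ι → E` a finite family and `u : E`. The coefficient vector `c_j := ⟪u, a_j⟫` satisfies

  `Σ_j ⟪u, a_j⟫² ≤ μ ‖u‖²`

whenever the Gram quadratic form of the family is dominated by `μ`:
`Σ_{i,j} c_i c_j ⟪a_i, a_j⟫ ≤ μ Σ_j c_j²` for all `c` (i.e. `‖G‖ ≤ μ` for the Gram matrix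
`G = (⟪a_i, a_j⟫)`, `μ ≥ 0`). Proof: with `v := Σ_j c_j a_j` one has `Σ c_j² = ⟪u, v⟫ ≤ ‖u‖ ‖v‖` and
`‖v‖² = Σ c_i c_j ⟪a_i, a_j⟫ ≤ μ Σ c_j²`, so `(Σ c_j²)² ≤ μ ‖u‖² Σ c_j²`.

Equivalently: the map `u ↦ (⟪u, a_j⟫)_j` has operator norm at most `√‖G‖` — the
`|AᵀU₁|² ≤ ‖AᵀA‖ ‖U₁‖²` step of a finite-rank approximate-inverse estimate.

## Why it is here (source and use)

Elementary linear algebra ([folklore]; e.g. Horn–Johnson 2013, §7.2 / Cauchy–Schwarz). It is the one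
"Gram relation" of the nonlinear constant `M₃` of the `H¹`-Schauder closing in the cell note
`pub-nsjs/pub-nsjs-typer/LEMMA-E.md` Lemma E.4 (Jia–Šverák programme, certified-enclosure lane; the
scheme is that of Hou–Wang–Yang, arXiv:2509.25116, which is under adjudication in that cell and is
NOT cited for this step — the inequality is re-derived here and kernel-checked): there
`a_j = λ̄_j⁻¹ Q ψ̄_j ∈ L²(Ω)`, `G = G_{Q²}` and `u = U₁`. Nothing about Navier–Stokes is typed here.
-/

open Finset

namespace Literature.Analysis.OperatorTheory

variable {E : Type*} [NormedAddCommGroup E] [InnerProductSpace ℝ E]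
variable {ι : Type*} [Fintype ι]

/-- The Gram quadratic form of a finite family `a`, evaluated at a coefficient vector `c`:
`Σ_{i,j} c_i c_j ⟪a_i, a_j⟫ = ‖Σ_j c_j a_j‖²`. [folklore] -/
theorem norm_sq_sum_smul_eq_gramForm (a : ι → E) (c : ι → ℝ) :
    ‖∑ j, c j • a j‖ ^ 2 = ∑ i, ∑ j, c i * c j * inner ℝ (a i) (a j) := by
  rw [← real_inner_self_eq_norm_sq, sum_inner]
  refine Finset.sum_congr rfl fun i _ => ?_
  rw [inner_sum]
  refine Finset.sum_congr rfl fun j _ => ?_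
  rw [real_inner_smul_left, real_inner_smul_right]
  ring

/-- **Gram bound.** If the Gram form of the family `a` is dominated by `μ ≥ 0`, then the squared
`ℓ²`-norm of the coefficient vector `(⟪u, a_j⟫)_j` is at most `μ ‖u‖²`. [folklore] -/
theorem sum_inner_sq_le_of_gramForm_le (a : ι → E) {μ : ℝ} (hμ : 0 ≤ μ)
    (hG : ∀ c : ι → ℝ, ∑ i, ∑ j, c i * c j * inner ℝ (a i) (a j) ≤ μ * ∑ j, c j ^ 2) (u : E) :
    ∑ j, (inner ℝ u (a j)) ^ 2 ≤ μ * ‖u‖ ^ 2 := by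
  set c : ι → ℝ := fun j => inner ℝ u (a j) with hc
  set v : E := ∑ j, c j • a j with hv
  set s : ℝ := ∑ j, c j ^ 2 with hs
  -- `s = ⟪u, v⟫`
  have h1 : s = inner ℝ u v := by
    rw [hv, inner_sum]
    refine Finset.sum_congr rfl fun j _ => ?_
    rw [real_inner_smul_right, hc]; ring
  -- `‖v‖² ≤ μ s`
  have h2 : ‖v‖ ^ 2 ≤ μ * s := by
    rw [hv, norm_sq_sum_smul_eq_gramForm]; exact hG c
  have hs0 : 0 ≤ s := Finset.sum_nonneg fun j _ => sq_nonneg _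
  -- `s² ≤ ‖u‖² ‖v‖² ≤ μ s ‖u‖²`
  have h3 : s ^ 2 ≤ μ * s * ‖u‖ ^ 2 := by
    have hcs : |inner ℝ u v| ≤ ‖u‖ * ‖v‖ := abs_real_inner_le_norm u v
    have : s ^ 2 ≤ (‖u‖ * ‖v‖) ^ 2 := by
      rw [h1]
      calc (inner ℝ u v) ^ 2 = |inner ℝ u v| ^ 2 := (sq_abs _).symm
        _ ≤ (‖u‖ * ‖v‖) ^ 2 := by gcongr
    calc s ^ 2 ≤ (‖u‖ * ‖v‖) ^ 2 := this
      _ = ‖u‖ ^ 2 * ‖v‖ ^ 2 := by ring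
      _ ≤ ‖u‖ ^ 2 * (μ * s) := by gcongr
      _ = μ * s * ‖u‖ ^ 2 := by ring
  rcases hs0.lt_or_eq with hpos | hzero
  · -- divide by `s > 0`
    have : s * s ≤ (μ * ‖u‖ ^ 2) * s := by nlinarith [h3]
    exact le_of_mul_le_mul_right this hpos
  · rw [← hzero]; positivity

/-- Specialisation to the matrix-norm form used in a certificate: if `μ` bounds every eigenvalue of
the Gram matrix in the sense `⟪c, G c⟫ ≤ μ ‖c‖²`, stated directly through the family — same content as
`sum_inner_sq_le_of_gramForm_le`, phrased for the coefficient map `u ↦ (⟪u, a_j⟫)_j` as an operator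
bound `‖(⟪u, a_j⟫)_j‖_{ℓ²} ≤ √μ ‖u‖`. [folklore] -/
theorem sqrt_sum_inner_sq_le_of_gramForm_le (a : ι → E) {μ : ℝ} (hμ : 0 ≤ μ)
    (hG : ∀ c : ι → ℝ, ∑ i, ∑ j, c i * c j * inner ℝ (a i) (a j) ≤ μ * ∑ j, c j ^ 2) (u : E) :
    Real.sqrt (∑ j, (inner ℝ u (a j)) ^ 2) ≤ Real.sqrt μ * ‖u‖ := by
  have h := sum_inner_sq_le_of_gramForm_le a hμ hG u
  calc Real.sqrt (∑ j, (inner ℝ u (a j)) ^ 2) ≤ Real.sqrt (μ * ‖u‖ ^ 2) := Real.sqrt_le_sqrt h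
    _ = Real.sqrt μ * ‖u‖ := by
      rw [Real.sqrt_mul hμ, Real.sqrt_sq (norm_nonneg _)]

end Literature.Analysis.OperatorTheory
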